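import Mathlib.Analysis.Analytic.Basic
import Mathlib.Analysis.Normed.Module.FiniteDimension
import Mathlib.Analysis.InnerProductSpace.Basic
import HarnessLib

/-!
# A line transversal to the tangent cone of a hypersurface: the cone condition along a line

Let `g` be analytic at `b` in a finite-dimensional complex normed space `K`, `g(b) = 0`, `g ≢ 0`
near `b`. Writing `g(b + h) = P_d(h) + O(‖h‖^{d+1})` with `P_d` the first non-vanishing diagonal
term of the power series (the **initial homogeneous form** of `g` at `b`, [Chirka1989, §8.2]),
every limit direction `u = lim (y_k - b)/‖y_k - b‖` of zeros `y_k → b` of `g` satisfies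
`P_d(u) = 0` (`apply_eq_zero_of_limit_direction`): the tangent cone of `{g = 0}` at `b` lies in
`{P_d = 0}` [Chirka1989, §8.4 Lemma 1 (easy inclusion)]. Consequently, for any `v` with
`P_d(v) ≠ 0` the complex line `ℂ v` meets the tangent cone only at `0`, which by compactness is
the **cone condition along the line** (`exists_line_cone_condition`): there is `θ > 0` with
`θ ‖y - b‖ ≤ ‖y - b - t v‖` for all `t ∈ ℂ` and all zeros `y` of `g` near `b` — the quantitative
form of "`b` is an isolated point of `{g = 0} ∩ (b + ℂv)` with `ℂ v ⊄ C({g = 0}, b)`" used to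
build projections satisfying `‖z - a‖ ≤ C ‖π(z - a)‖` on an analytic set
(`ConeConditionDirection.lean`), the hypothesis of the comparison theorem for Lelong numbers
[Demailly, *Complex analytic and differential geometry*, Ch. III Thm. 7.7; Chirka1989, §15.1].

## References

* E. M. Chirka, *Complex Analytic Sets*, Kluwer 1989, §8.1–8.2, §8.4 Lemma 1 [Chirka1989].
-/

noncomputable section

open scoped Topology
open Set Filter Metric Asymptotics

namespace Literature.Geometry.Kaehler

variable {K : Type*} [NormedAddCommGroup K] [NormedSpace ℂ K]

/-! ### The initial form -/

/-- **The initial (lowest non-vanishing diagonal) term of the power series of `g ≢ 0`**: there is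
`d` such that the diagonals `y ↦ p_i(y, …, y)` vanish identically for `i < d` while
`p_d(v, …, v) ≠ 0` for some `v`. [cite: Chirka1989, §8.2] -/
theorem exists_order_diagonal {g : K → ℂ} {b : K} {pf : FormalMultilinearSeries ℂ K ℂ}
    (hg : HasFPowerSeriesAt g pf b) (hne : ¬ g =ᶠ[𝓝 b] 0) :
    ∃ d : ℕ, (∀ i < d, ∀ y : K, pf i (fun _ => y) = 0) ∧ ∃ v : K, pf d (fun _ => v) ≠ 0 := by
  by_contra H
  push Not at H
  -- all diagonals vanish
  have hall : ∀ d (y : K), pf d (fun _ => y) = 0 := by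
    intro d
    induction d using Nat.strong_induction_on with
    | _ d ih => exact H d fun i hi y => ih i hi y
  apply hne
  have h1 : ∀ᶠ y in 𝓝 (0 : K), g (b + y) = 0 := by
    filter_upwards [hg.eventually_hasSum] with y hy
    have : HasSum (fun n => pf n fun _ => y) 0 := by
      simp only [hall]; exact hasSum_zero
    exact hy.unique this
  have ht : Tendsto (fun z : K => z - b) (𝓝 b) (𝓝 0) := tendsto_sub_nhds_zero_iff.2 tendsto_id
  filter_upwards [ht.eventually h1] with z hz
  simpa using hz

/-- The diagonal of a continuous multilinear map is continuous. [folklore] -/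
theorem continuous_diagonal {d : ℕ} (P : ContinuousMultilinearMap ℂ (fun _ : Fin d => K) ℂ) :
    Continuous fun y : K => P fun _ => y :=
  P.cont.comp (continuous_pi fun _ => continuous_id)

/-- Homogeneity of the diagonal: `P(c y, …, c y) = c^d P(y, …, y)`. [folklore] -/
theorem diagonal_smul {d : ℕ} (P : ContinuousMultilinearMap ℂ (fun _ : Fin d => K) ℂ) (c : ℂ) (y : K) :
    P (fun _ => c • y) = c ^ d * P (fun _ => y) := by
  have := P.map_smul_univ (fun _ : Fin d => c) (fun _ => y)
  simp only [Finset.prod_const, Finset.card_univ, Fintype.card_fin, smul_eq_mul] at this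
  exact this

/-- **Limit directions of zeros annihilate the initial form**: if `g(b + h_k) = 0`, `h_k → 0`,
`h_k ≠ 0` and `h_k/‖h_k‖ → u`, then `p_d(u, …, u) = 0` for the initial degree `d`
(Taylor: `0 = g(b + h_k) = p_d(h_k) + O(‖h_k‖^{d+1})`, divide by `‖h_k‖^d`).
[cite: Chirka1989, §8.4 Lemma 1] -/
theorem apply_eq_zero_of_limit_direction {g : K → ℂ} {b : K} {pf : FormalMultilinearSeries ℂ K ℂ}
    (hg : HasFPowerSeriesAt g pf b) {d : ℕ} (hlow : ∀ i < d, ∀ y : K, pf i (fun _ => y) = 0)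
    {h : ℕ → K} (h0 : ∀ k, g (b + h k) = 0) (hne : ∀ k, h k ≠ 0) (hlim : Tendsto h atTop (𝓝 0))
    {u : K} (hu : Tendsto (fun k => ((‖h k‖⁻¹ : ℝ) : ℂ) • h k) atTop (𝓝 u)) :
    pf d (fun _ => u) = 0 := by
  -- the partial sum of order `d + 1` is the initial form
  have hps : ∀ y : K, pf.partialSum (d + 1) y = pf d (fun _ => y) := by
    intro y
    rw [FormalMultilinearSeries.partialSum, Finset.sum_range_succ, Finset.sum_eq_zero, zero_add]
    intro i hi
    exact hlow i (Finset.mem_range.1 hi) y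
  obtain ⟨C, hC⟩ := (hg.isBigO_sub_partialSum_pow (d + 1)).bound
  have hbound : ∀ᶠ k in atTop, ‖pf d (fun _ => h k)‖ ≤ C * ‖h k‖ ^ (d + 1) := by
    filter_upwards [hlim.eventually hC] with k hk
    rw [h0 k, hps, zero_sub, norm_neg] at hk
    simpa [Real.norm_eq_abs, abs_of_nonneg (pow_nonneg (norm_nonneg _) _)] using hk
  -- `p_d(u_k) → 0`
  have hlim0 : Tendsto (fun k => pf d (fun _ => ((‖h k‖⁻¹ : ℝ) : ℂ) • h k)) atTop (𝓝 0) := by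
    refine squeeze_zero_norm' (a := fun k => C * ‖h k‖) ?_ ?_
    · filter_upwards [hbound] with k hk
      rw [diagonal_smul, norm_mul, norm_pow, Complex.norm_real, norm_inv, norm_norm]
      have hpos : 0 < ‖h k‖ := norm_pos_iff.2 (hne k)
      calc ‖h k‖⁻¹ ^ d * ‖pf d fun _ => h k‖ ≤ ‖h k‖⁻¹ ^ d * (C * ‖h k‖ ^ (d + 1)) := by
            gcongr
        _ = C * ‖h k‖ := by
            rw [pow_succ, inv_pow, ← mul_assoc, ← mul_assoc, mul_comm (‖h k‖ ^ d)⁻¹ C, mul_assoc C,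
              inv_mul_cancel₀ (pow_ne_zero _ hpos.ne'), mul_one]
    · have : Tendsto (fun k => C * ‖h k‖) atTop (𝓝 (C * ‖(0 : K)‖)) :=
        (tendsto_const_nhds.mul hlim.norm)
      simpa using this
  have hlimu : Tendsto (fun k => pf d (fun _ => ((‖h k‖⁻¹ : ℝ) : ℂ) • h k)) atTop
      (𝓝 (pf d fun _ => u)) := ((continuous_diagonal (pf d)).tendsto u).comp hu
  exact tendsto_nhds_unique hlimu hlim0

/-! ### The cone condition along a good line -/

/-- **The cone condition along a line transversal to the initial form.** For `g` analytic at `b`,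
`g(b) = 0`, `g ≢ 0` near `b` (finite-dimensional `K`), there are `v ≠ 0` and `θ > 0` such that
`θ ‖y - b‖ ≤ ‖y - b - t v‖` for every `t ∈ ℂ` and every zero `y` of `g` near `b`: the complex line
`ℂ v` meets the tangent cone of `{g = 0}` at `b` only at the vertex (`v` with `p_d(v) ≠ 0`).
[cite: Chirka1989, §8.4 Lemma 1, §8.1 Prop. 1] -/
theorem exists_line_cone_condition [FiniteDimensional ℂ K] {g : K → ℂ} {b : K} (hg : AnalyticAt ℂ g b)
    (hgb : g b = 0) (hne : ¬ g =ᶠ[𝓝 b] 0) :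
    ∃ v : K, v ≠ 0 ∧ ∃ θ : ℝ, 0 < θ ∧
      ∀ᶠ y in 𝓝 b, g y = 0 → ∀ t : ℂ, θ * ‖y - b‖ ≤ ‖y - b - t • v‖ := by
  classical
  obtain ⟨pf, hpf⟩ := hg
  obtain ⟨d, hlow, v, hv⟩ := exists_order_diagonal hpf hne
  have hd : d ≠ 0 := by
    rintro rfl
    exact hv (by rw [hpf.coeff_zero]; exact hgb)
  haveI : Nonempty (Fin d) := ⟨⟨0, Nat.pos_of_ne_zero hd⟩⟩
  have hv0 : v ≠ 0 := by
    rintro rfl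
    exact hv ((pf d).map_zero)
  refine ⟨v, hv0, ?_⟩
  by_contra H
  push Not at H
  -- a sequence of zeros violating the cone condition with constants `1/(k+1)`
  have hseq : ∀ k : ℕ, ∃ y : K, ∃ t : ℂ, g y = 0 ∧ dist y b < 1 / (k + 1) ∧
      ‖y - b - t • v‖ < 1 / (k + 1) * ‖y - b‖ := by
    intro k
    have hk : (0 : ℝ) < 1 / (k + 1) := by positivity
    obtain ⟨y, ⟨hgy, t, ht⟩, hyb⟩ := ((H (1 / (k + 1)) hk).and_eventually (ball_mem_nhds b hk)).exists
    exact ⟨y, t, hgy, hyb, ht⟩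
  choose y t hgy hyb hyt using hseq
  set h : ℕ → K := fun k => y k - b with hh
  have hne' : ∀ k, h k ≠ 0 := by
    intro k hk
    have := hyt k
    rw [show y k - b = h k from rfl, hk, zero_sub, norm_neg, norm_zero, mul_zero] at this
    exact absurd this (not_lt.2 (norm_nonneg _))
  have hlim : Tendsto h atTop (𝓝 0) := by
    rw [tendsto_iff_norm_sub_tendsto_zero]
    simp only [sub_zero]
    have h1 : ∀ k, ‖h k‖ ≤ 1 / ((k : ℝ) + 1) := fun k => by
      rw [hh]; simpa [dist_eq_norm] using (hyb k).le
    exact squeeze_zero (fun k => norm_nonneg _) h1 tendsto_one_div_add_atTop_nhds_zero_nat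
  -- normalised directions and coefficients
  set u : ℕ → K := fun k => ((‖h k‖⁻¹ : ℝ) : ℂ) • h k with hu
  set s : ℕ → ℂ := fun k => ((‖h k‖⁻¹ : ℝ) : ℂ) * t k with hs
  have hunorm : ∀ k, ‖u k‖ = 1 := fun k => by
    rw [hu]
    simp only [norm_smul, Complex.norm_real, norm_inv, norm_norm]
    exact inv_mul_cancel₀ (norm_ne_zero_iff.2 (hne' k))
  have hus : ∀ k, ‖u k - s k • v‖ < 1 / (k + 1) := by
    intro k
    have hpos : 0 < ‖h k‖ := norm_pos_iff.2 (hne' k)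
    have : u k - s k • v = ((‖h k‖⁻¹ : ℝ) : ℂ) • (h k - t k • v) := by
      rw [hu, hs, smul_sub, mul_smul]
    rw [this, norm_smul, Complex.norm_real, norm_inv, norm_norm, inv_mul_lt_iff₀ hpos, mul_comm]
    exact hyt k
  have hsbound : ∀ k, ‖s k‖ ≤ 2 / ‖v‖ := by
    intro k
    have hvpos : 0 < ‖v‖ := norm_pos_iff.2 hv0
    rw [le_div_iff₀ hvpos, ← norm_smul]
    have h1 : ‖s k • v‖ ≤ ‖u k‖ + ‖u k - s k • v‖ := by
      calc ‖s k • v‖ = ‖u k - (u k - s k • v)‖ := by rw [sub_sub_cancel]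
        _ ≤ ‖u k‖ + ‖u k - s k • v‖ := norm_sub_le _ _
    have h2 : (1 : ℝ) / (k + 1) ≤ 1 := by
      rw [div_le_one (by positivity)]; linarith [k.cast_nonneg (α := ℝ)]
    linarith [hunorm k, hus k]
  -- compactness: a convergent subsequence of `(u_k, s_k)`
  haveI : ProperSpace K := FiniteDimensional.proper ℂ K
  have hcpt : IsCompact (sphere (0 : K) 1 ×ˢ closedBall (0 : ℂ) (2 / ‖v‖)) :=
    (isCompact_sphere 0 1).prod (isCompact_closedBall 0 _)
  obtain ⟨⟨u₀, s₀⟩, hmem, φ, hφ, hconv⟩ := hcpt.tendsto_subseq (x := fun k => (u k, s k))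
    fun k => ⟨by simp [hunorm k], by simpa using hsbound k⟩
  have hu₀ : ‖u₀‖ = 1 := by simpa using hmem.1
  have hconv_u : Tendsto (u ∘ φ) atTop (𝓝 u₀) := (continuous_fst.tendsto _).comp hconv
  have hconv_s : Tendsto (s ∘ φ) atTop (𝓝 s₀) := (continuous_snd.tendsto _).comp hconv
  -- `u₀ = s₀ v`
  have hus₀ : u₀ = s₀ • v := by
    have h1 : Tendsto (fun k => u (φ k) - s (φ k) • v) atTop (𝓝 (u₀ - s₀ • v)) :=
      hconv_u.sub (hconv_s.smul_const v)
    have h2 : Tendsto (fun k => u (φ k) - s (φ k) • v) atTop (𝓝 0) := by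
      rw [tendsto_iff_norm_sub_tendsto_zero]
      simp only [sub_zero]
      refine squeeze_zero (fun k => norm_nonneg _) (fun k => (hus (φ k)).le) ?_
      have hφt : Tendsto (fun k => (φ k : ℝ)) atTop atTop :=
        tendsto_natCast_atTop_atTop.comp hφ.tendsto_atTop
      have : Tendsto (fun k => 1 / ((φ k : ℝ) + 1)) atTop (𝓝 0) :=
        tendsto_one_div_add_atTop_nhds_zero_nat.comp hφ.tendsto_atTop
      exact this
    exact sub_eq_zero.1 (tendsto_nhds_unique h1 h2)
  -- the initial form vanishes at `u₀`, contradiction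
  have hPu₀ : pf d (fun _ => u₀) = 0 :=
    apply_eq_zero_of_limit_direction hpf hlow (h := h ∘ φ) (fun k => by
      show g (b + (y (φ k) - b)) = 0; rw [add_sub_cancel]; exact hgy (φ k))
      (fun k => hne' (φ k)) (hlim.comp hφ.tendsto_atTop) hconv_u
  rw [hus₀, diagonal_smul] at hPu₀
  rcases mul_eq_zero.1 hPu₀ with h0 | h0
  · have : s₀ = 0 := pow_eq_zero_iff hd |>.1 h0
    rw [this, zero_smul] at hus₀
    rw [hus₀, norm_zero] at hu₀
    exact zero_ne_one hu₀
  · exact hv h0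

end Literature.Geometry.Kaehler

end
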